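import Literature.NumberTheory.Automorphic.ArchInnerFormChartOrbLocalSmooth     -- ★ (7)′ layer (i) (LH3-p04 (g7)) p852086: `contDiffOn_chartOrbGLoc_cpt_of_injective`, `isOpen_setOf_injective_circleExpLoc`; brings ★ `uniformlyProper_gprimeBlock_cpt_of_injective`
import Literature.NumberTheory.Automorphic.ArchInnerFormChartOrbLocalCongr      -- ★ (LH3-p03): `chartOrbGLoc_eq_of_mem_iff` (the label `S′` enters the one-place functional only through `w ∈ S′`)
import Literature.NumberTheory.Rogawski1990.ArchEPGeneratorHead                 -- ★ (12′) E1 (LH7-p01 (g7)) p852045: `EPGeneratorAt`, `epGeneratorAt_iff`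
import Literature.NumberTheory.Rogawski1990.ArchBouazizClassTubeG               -- ★ (7) F1 p852005: `exists_pos_not_split_and_compact_nearG` (no split chart point near a regular class that has a compact witness)
import Literature.NumberTheory.Rogawski1990.ArchBouazizClassMapSectionG         -- ★ (7) F3 (LH10-p02 (g9)) p852021: `exists_section_compactPlaceG` (smooth local section of `esymm3 ∘ e^{i·}` at a regular unit triple)
import Literature.NumberTheory.Rogawski1990.ArchBouazizChartDescentG            -- ★ (7) F6b (F0P3a-p04 (g27)) p852010: `exists_perm_of_esymm3_eq` (same symmetric data, injective ⇒ a permutation)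
import Literature.NumberTheory.Rogawski1990.ArchBouazizClassDescent             -- ★ (Σ4c) (LH10-p01): `exists_contDiff_eq_one_closedBall_tsupport_subset`, `contDiff_ofReal_mul_of_tsupport_subset` (cutoff calculus)
import Literature.NumberTheory.Rogawski1990.ArchBouazizStableFamilyLinear       -- ★ (S-lin) (LH3-p02): `integrable_descConj_of_uniformlyProper` (generic)
import Literature.NumberTheory.Automorphic.ArchEndoscopicChartOrbLocalPos         -- ★ (N2): `integral_descConj_pos_of_nonneg` (generic); brings ★ `isOpenPosMeasure_quotientMeasure`
import HarnessLib

/-!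
# THE REGULAR ONE-PLACE EULER–POINCARÉ GENERATOR: `EPGeneratorAt L α w ν_w (esymm3 l)` at every REGULAR ELLIPTIC base class (`‖l_i‖ = 1`, `l` injective) of `U(α)_w`
# (Rogawski 1990 §8.2; Shelstad 1979 §4; Bouaziz 1994 §6.2)

Topic `NumberTheory/Rogawski1990`; namespace `Literature.NumberTheory.Rogawski1990`.  THEOREMS ONLY (no `def`, no instance, no notation, no axiom, no named fact, no `sorry`).
Cell `pub/hodgecm-mathlib`, crux H413 (`stmt-HodgeConjecture-24833`), F0∕P3c road «N8-INNER» ROAD B «EULER–POINCARÉ ROAD» (owner LH2-plan (g1), 2026-09-02T16:08:52Z ∕ GO 16:17:17Z),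
brick **(7) F7′ «REGULAR EP GENERATOR (one place)»** (RULING 16:23:36Z: pen LH3-p04 (g7)), layer (ii) = the generator itself; layer (i) = ★ `ArchInnerFormChartOrbLocalSmooth`.  The first
of the three one-place generators (7) regular ∕ (8) wall ∕ (10) scalar corner that the EP assembly (12′) (LH7-p01 (g7), binder `hEP` of E3) consumes BY NAME.  Count-neutral.

THE MATHEMATICS (one complex place `w`, house frame `α` with `α_i ≠ 0`, Haar `ν_w` on `U(α)_w = archLocal L 3 (diagonal α) w`, base class `b = esymm3 l`, `l = (e^{iθ₀ₖ})ₖ` pairwise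
distinct).  TEST FUNCTION: a one-place non-negative bump `f = φ ∘ (↑↑·)` of the (KN) class, `φ` a `ContDiffBump` on `M₃(ℂ)` centred at the matrix of the regular elliptic element
`γ₀ = gprimeBlockAt α w ∅ θ₀`, supported in a closed ball of invertible matrices (the units of the Banach algebra `M₃(ℂ)` are open; `U(α)_w ≤ GL₃(ℂ)` is closed, ★ `isClosed_archLocal`),
`f ≥ 0`, `f(γ₀) = 1` (§1).  SPLIT CLAUSE: VACUOUS — `b` is a REGULAR class with the compact witness `bzClassMapG ∅ (θ₀) w = b`, so by ★ F1 `exists_pos_not_split_and_compact_nearG` NO chart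
split at `w` has its `w`-class `δ`-close to `b` (§4).  COMPACT CLAUSE: at a label `S′ ∌ w` the one-place functional is that of the empty label (★ `chartOrbGLoc_eq_of_mem_iff`), so consider
`Φ(cw) := Σ_{σ ∈ S₃} chartOrbGLoc α w ∅ ν_w f (cw ∘ σ)`: it is `C^∞` on the regular set `{e^{i cw_k} pairwise distinct}` (★ layer (i), Harish-Chandra), `S₃`-INVARIANT (reindexing) and a
function of the PHASES `e^{i cw_k}` only (★ `gprimeBlockAt_eq_of_not_mem_of_circleExp_eq`) (§3); hence it DESCENDS through the class map `cw ↦ esymm3 (e^{i cw})`, which is étale at regular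
points: with the smooth local section `τ` of ★ F3 `exists_section_compactPlaceG` (`τ(b) = θ₀`), `h := χ · (Φ ∘ τ)` (`χ` a cutoff `= 1` on the closed `ε`-ball, supported where `τ` is smooth
and regular, ★ `contDiff_ofReal_mul_of_tsupport_subset`) is `C^∞` on `ℂ³`, and at every regular `cw` with `dist (esymm3 (e^{i cw}), b) < ε` the regular triples `e^{iτ(z)}` and `e^{i cw}`
(`z` the class) have the same symmetric data, so differ by a permutation `π` (★ F6b `exists_perm_of_esymm3_eq`), whence `h(z) = Φ(τ z) = Φ(cw ∘ π) = Φ(cw)` (§4).  NON-VANISHING: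
`h(b) = Φ(θ₀)`, a complex number of POSITIVE real part — every slot term is the orbital integral of `f ≥ 0` (a non-negative real, §2), and the `σ = 1` term is POSITIVE because
`f(γ₀) = 1 > 0`, the invariant quotient measure charges open sets (★ `isOpenPosMeasure_quotientMeasure`), the integrand is integrable at the regular point (★ `integrable_descConj_of_uniformlyProper`
over ★ `uniformlyProper_gprimeBlock_cpt_of_injective`) and the box mass is positive (★ `chartBoxImgGLoc_eq_univ_of_not_mem`) — ★ F5 `chartOrbG_ofReal_re_pos` read at ONE place (§2).
* §1 `exists_onePlaceBump_eq_one` — the (KN)-class non-negative one-place bump `= 1` at a prescribed `γ₀ ∈ U(α)_w`.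
* §2 `chartOrbGLoc_ofReal`, `chartOrbGLoc_ofReal_re_nonneg`, `chartOrbGLoc_ofReal_re_pos` — the one-place functional of a real `f` is real, `≥ 0` for `f ≥ 0`, `> 0` at a regular compact-chart
  point where `f` is positive.
* §3 `sum_perm_chartOrbGLoc_congr_of_circleExp_eq` (phases only), `sum_perm_chartOrbGLoc_comp_perm` (`S₃`-invariance), `contDiffOn_sum_perm_chartOrbGLoc` (smooth on the regular set),
  `sum_perm_chartOrbGLoc_ofReal_re_pos` (positive real part).
* §4 `exists_angles_of_norm_eq_one`, `bzClassMapG_apply_of_not_mem`; HEADS **`epGeneratorAt_esymm3_of_injective`** `(hα) {l} (hl : ∀ i, ‖l i‖ = 1) (hinj : Injective l) :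
  EPGeneratorAt L α w νw (esymm3 l)` and **`epGeneratorAt_esymm3_of_cubicDisc_ne_zero`** (the `cubicDisc (esymm3 l) ≠ 0` spelling, ★ `cubicDisc_esymm3_ne_zero_iff`).
HONEST LABEL: HC_CM is proved only modulo the 7 printed citations (2 remaining: hLiu418 = `stmt-HodgeConjecture-24832`, h413 = `stmt-HodgeConjecture-24833`) until rung 0 closes; this file
is one input of the EP assembly (12′) and pays nothing by itself.

## References
* [Rogawski1990] J. D. Rogawski, *Automorphic Representations of Unitary Groups in Three Variables*, Ann. of Math. Stud. 123 (1990), §3.6 p. 28 (Cartan subgroups and classes of `U(2,1)`),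
  §8.2 pp. 118–122 (orbital integrals on the compact Cartan, place by place), §14.2 (14.2.1) p. 232.
* [Shelstad1979] D. Shelstad, *Characters and inner forms of a quasi-split group over ℝ*, Compositio Math. 39 (1979), §4 pp. 22–26, Lemma 4.2 p. 23 (stable orbital integrals = slot sums,
  smooth on the regular set).
* [Bouaziz1994IntegralesOrbitales] A. Bouaziz, *Intégrales orbitales sur les groupes de Lie réductifs*, Ann. Sci. ÉNS (4) 27 (1994), §5.1 p. 588, §6.2 pp. 591–594 (invariant functions
  near a regular class are smooth functions of the class).
* [Varadarajan1989] V. S. Varadarajan, *An Introduction to Harmonic Analysis on Semisimple Lie Groups* (1989), §2.4 Thm. 8 (smoothness of orbital integrals on the regular set).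
* [DeitmarEchterhoff2014] A. Deitmar, S. Echterhoff, *Principles of Harmonic Analysis*, 2nd ed. (2014), Thm. 1.5.3 (the quotient integral formula; invariant measures charge open sets).
* [Borel1972] A. Borel, *Représentations de groupes localement compacts*, LNM 276 (1972), 3.4 (smooth compactly supported bumps on a Lie group).
-/

set_option autoImplicit false

noncomputable section

open MeasureTheory MeasureTheory.Measure NumberField NumberField.InfinitePlace Matrix Complex Topology Metric Set Function
open Literature.MeasureTheory.Group Literature.NumberTheory.Automorphic Literature.NumberTheory.Automorphic.UnitaryGroup Literature.NumberTheory.Automorphic.ArchCartan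
open scoped MatrixGroups Matrix ContDiff Classical ENNReal Matrix.Norms.Operator

namespace Literature.NumberTheory.Rogawski1990

/-! ## §1 A non-negative one-place test function of the (KN) class with value `1` at a prescribed point -/

section Bump

variable (L : Type) [Field L] [NumberField L] [IsCMField L] (α : Fin 3 → L) (w : {w : InfinitePlace L // IsComplex w})

omit [NumberField L] [IsCMField L] in
/-- **A NON-NEGATIVE ONE-PLACE TEST FUNCTION OF THE (KN) CLASS, `= 1` AT A PRESCRIBED `γ₀ ∈ U(α)_w`**: `f₀ = φ ∘ (↑↑·)` with `φ` a smooth bump on `M₃(ℂ)` centred at `↑↑γ₀` whose support is a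
closed ball of INVERTIBLE matrices (the units of the Banach algebra `M₃(ℂ)` are open, `Units.isOpenEmbedding_val`); `f₀` is continuous, compactly supported (`U(α)_w ≤ GL₃(ℂ)` is closed,
★ `isClosed_archLocal`, and `GL₃(ℂ) → M₃(ℂ)` is an embedding), `0 ≤ f₀`, `f₀ γ₀ = 1`, and `(f₀ : ℂ) = fa ∘ (↑↑·)` with `fa = (φ : ℂ)` smooth on `M₃(ℂ)` — the one-place test class of ★
`EPGeneratorAt`. [cite: Borel1972, 3.4] [cite: Rogawski1990, §8.2 p. 122] -/
theorem exists_onePlaceBump_eq_one (γ₀ : ↥(archLocal L 3 (Matrix.diagonal α) w)) :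
    ∃ f₀ : ↥(archLocal L 3 (Matrix.diagonal α) w) → ℝ, Continuous f₀ ∧ HasCompactSupport f₀ ∧ (∀ g, 0 ≤ f₀ g) ∧ f₀ γ₀ = 1 ∧
      ∃ fa : Matrix (Fin 3) (Fin 3) ℂ → ℂ, ContDiff ℝ ∞ fa ∧
        ∀ g : ↥(archLocal L 3 (Matrix.diagonal α) w), ((f₀ g : ℝ) : ℂ) = fa (((g : GL (Fin 3) ℂ)) : Matrix (Fin 3) (Fin 3) ℂ) := by
  -- a ball of invertible matrices around `↑↑γ₀`
  have hopen : IsOpen (Set.range (Units.val : GL (Fin 3) ℂ → Matrix (Fin 3) (Fin 3) ℂ)) :=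
    (Units.isOpenEmbedding_val (R := Matrix (Fin 3) (Fin 3) ℂ)).isOpen_range
  obtain ⟨r, hr, hball⟩ := Metric.isOpen_iff.1 hopen (((γ₀ : GL (Fin 3) ℂ)) : Matrix (Fin 3) (Fin 3) ℂ) ⟨(γ₀ : GL (Fin 3) ℂ), rfl⟩
  -- the bump, supported in the closed ball of radius `r ∕ 2`
  let φ : ContDiffBump ((((γ₀ : GL (Fin 3) ℂ)) : Matrix (Fin 3) (Fin 3) ℂ)) := ⟨r / 4, r / 2, by positivity, by linarith⟩
  have hK : IsCompact ((Units.val : GL (Fin 3) ℂ → Matrix (Fin 3) (Fin 3) ℂ) ⁻¹' Metric.closedBall ((((γ₀ : GL (Fin 3) ℂ)) : Matrix (Fin 3) (Fin 3) ℂ)) (r / 2)) := by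
    haveI : ProperSpace (Matrix (Fin 3) (Fin 3) ℂ) := FiniteDimensional.proper ℝ _
    exact (Units.isOpenEmbedding_val (R := Matrix (Fin 3) (Fin 3) ℂ)).isInducing.isCompact_preimage' (isCompact_closedBall _ _)
      ((Metric.closedBall_subset_ball (by linarith)).trans hball)
  have hK' : IsCompact ((Subtype.val : ↥(archLocal L 3 (Matrix.diagonal α) w) → GL (Fin 3) ℂ) ⁻¹'
      ((Units.val : GL (Fin 3) ℂ → Matrix (Fin 3) (Fin 3) ℂ) ⁻¹' Metric.closedBall ((((γ₀ : GL (Fin 3) ℂ)) : Matrix (Fin 3) (Fin 3) ℂ)) (r / 2))) :=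
    (isClosed_archLocal L 3 (Matrix.diagonal α) w).isClosedEmbedding_subtypeVal.isCompact_preimage hK
  have hKc : IsClosed ((Subtype.val : ↥(archLocal L 3 (Matrix.diagonal α) w) → GL (Fin 3) ℂ) ⁻¹'
      ((Units.val : GL (Fin 3) ℂ → Matrix (Fin 3) (Fin 3) ℂ) ⁻¹' Metric.closedBall ((((γ₀ : GL (Fin 3) ℂ)) : Matrix (Fin 3) (Fin 3) ℂ)) (r / 2))) :=
    (Metric.isClosed_closedBall.preimage Units.continuous_val).preimage continuous_subtype_val
  refine ⟨fun g => φ (((g : GL (Fin 3) ℂ)) : Matrix (Fin 3) (Fin 3) ℂ), φ.continuous.comp (Units.continuous_val.comp continuous_subtype_val),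
    HasCompactSupport.intro' hK' hKc fun g hg => ?_, fun g => φ.nonneg, φ.one_of_mem_closedBall (Metric.mem_closedBall_self (by positivity)),
    fun M => ((φ M : ℝ) : ℂ), Complex.ofRealCLM.contDiff.comp φ.contDiff, fun g => rfl⟩
  -- outside the compact set the bump vanishes
  have hdist : r / 2 < dist ((((g : GL (Fin 3) ℂ)) : Matrix (Fin 3) (Fin 3) ℂ)) ((((γ₀ : GL (Fin 3) ℂ)) : Matrix (Fin 3) (Fin 3) ℂ)) := by
    simpa only [Set.mem_preimage, Metric.mem_closedBall, not_le] using hg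
  exact φ.zero_of_le_dist hdist.le

end Bump

/-! ## §2 The one-place functional of a real non-negative test function: real, non-negative, positive at regular points -/

section Positivity

variable (L : Type) [Field L] [NumberField L] [IsCMField L] (α : Fin 3 → L) (w : {w : InfinitePlace L // IsComplex w}) (S' : Finset {w : InfinitePlace L // IsComplex w})
  [MeasurableSpace ↥(archLocal L 3 (Matrix.diagonal α) w)] [BorelSpace ↥(archLocal L 3 (Matrix.diagonal α) w)]
  (νw : Measure ↥(archLocal L 3 (Matrix.diagonal α) w)) [νw.IsHaarMeasure] [νw.IsMulRightInvariant]

/-- **The one-place functional of a real function is real**: `chartOrbGLoc α w S′ ν_w (f : ℂ) cw = ↑(dt′_w(B′) · ∫ f(y γ y⁻¹))`. [cite: Rogawski1990, §8.2 p. 122] [cite: DeitmarEchterhoff2014, Thm. 1.5.3] -/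
theorem chartOrbGLoc_ofReal (f : ↥(archLocal L 3 (Matrix.diagonal α) w) → ℝ) (cw : Fin 3 → ℝ) :
    chartOrbGLoc L α w S' νw (fun g => ((f g : ℝ) : ℂ)) cw =
      (letI : MeasurableSpace (↥(archLocal L 3 (Matrix.diagonal α) w) ⧸ chartTorusGLoc L α w S') := borel _
       (((chartHaarGLoc L α w S' (chartBoxImgGLoc L α w S')).toReal *
          ∫ y, descConj (gprimeBlockAt L α w S' cw) (chartTorusGLoc L α w S') (forall_mem_chartTorusGLoc_comm L α w S' cw) f y ∂(chartQuotientMeasureGLoc L α w S' νw) : ℝ) : ℂ)) := by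
  letI : MeasurableSpace (↥(archLocal L 3 (Matrix.diagonal α) w) ⧸ chartTorusGLoc L α w S') := borel _
  haveI : BorelSpace (↥(archLocal L 3 (Matrix.diagonal α) w) ⧸ chartTorusGLoc L α w S') := ⟨rfl⟩
  rw [chartOrbGLoc_def]
  have hcomp : descConj (gprimeBlockAt L α w S' cw) (chartTorusGLoc L α w S') (forall_mem_chartTorusGLoc_comm L α w S' cw)
        (fun g : ↥(archLocal L 3 (Matrix.diagonal α) w) => ((f g : ℝ) : ℂ)) =
      fun y => ((descConj (gprimeBlockAt L α w S' cw) (chartTorusGLoc L α w S') (forall_mem_chartTorusGLoc_comm L α w S' cw) f y : ℝ) : ℂ) := by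
    funext y
    induction y using QuotientGroup.induction_on with
    | H g => rfl
  rw [hcomp, integral_complex_ofReal, Complex.ofReal_mul]

/-- **For `f ≥ 0` the one-place functional is a non-negative real.** [cite: Rogawski1990, §8.2 p. 122] [cite: DeitmarEchterhoff2014, Thm. 1.5.3] -/
theorem chartOrbGLoc_ofReal_re_nonneg {f : ↥(archLocal L 3 (Matrix.diagonal α) w) → ℝ} (h0 : ∀ g, 0 ≤ f g) (cw : Fin 3 → ℝ) :
    0 ≤ (chartOrbGLoc L α w S' νw (fun g => ((f g : ℝ) : ℂ)) cw).re ∧ (chartOrbGLoc L α w S' νw (fun g => ((f g : ℝ) : ℂ)) cw).im = 0 := by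
  letI : MeasurableSpace (↥(archLocal L 3 (Matrix.diagonal α) w) ⧸ chartTorusGLoc L α w S') := borel _
  haveI : BorelSpace (↥(archLocal L 3 (Matrix.diagonal α) w) ⧸ chartTorusGLoc L α w S') := ⟨rfl⟩
  rw [chartOrbGLoc_ofReal, Complex.ofReal_re, Complex.ofReal_im]
  refine ⟨mul_nonneg ENNReal.toReal_nonneg (integral_nonneg fun y => ?_), rfl⟩
  induction y using QuotientGroup.induction_on with
  | H g => exact h0 _

/-- **POSITIVITY AT A REGULAR COMPACT-CHART POINT**: for a Haar `ν_w`, `f ≥ 0` continuous with compact support, an admissible label `S′ ∌ w` and a REGULAR one-place coordinate `cw`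
(`e^{i cw_k}` pairwise distinct: the quotient integrand is integrable, ★ `integrable_descConj_of_uniformlyProper` over ★ `uniformlyProper_gprimeBlock_cpt_of_injective`) with
`f(gprimeBlockAt α w S′ cw) > 0`, the one-place functional is a POSITIVE real (the invariant quotient measure charges open sets, ★ `isOpenPosMeasure_quotientMeasure`; the box mass is positive,
★ `chartBoxImgGLoc_eq_univ_of_not_mem`) — ★ F5 `chartOrbG_ofReal_re_pos` read at ONE place. [cite: Rogawski1990, §8.2 p. 122] [cite: DeitmarEchterhoff2014, Thm. 1.5.3] [cite: Shelstad1979, §4 p. 22] -/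
theorem chartOrbGLoc_ofReal_re_pos (hα : ∀ i, α i ≠ 0) (hS' : ∀ w, w ∈ S' → w ∈ splitChartPlaces L α) (hw : w ∉ S')
    {f : ↥(archLocal L 3 (Matrix.diagonal α) w) → ℝ} (hf : Continuous f) (hfc : HasCompactSupport f) (h0 : ∀ g, 0 ≤ f g) {cw : Fin 3 → ℝ}
    (hcw : Function.Injective fun i : Fin 3 => Circle.exp (cw i)) (hpos : 0 < f (gprimeBlockAt L α w S' cw)) :
    0 < (chartOrbGLoc L α w S' νw (fun g => ((f g : ℝ) : ℂ)) cw).re := by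
  letI : MeasurableSpace (↥(archLocal L 3 (Matrix.diagonal α) w) ⧸ chartTorusGLoc L α w S') := borel _
  haveI : BorelSpace (↥(archLocal L 3 (Matrix.diagonal α) w) ⧸ chartTorusGLoc L α w S') := ⟨rfl⟩
  haveI := locallyCompactSpace_archLocal_three L α w
  haveI := secondCountableTopology_archLocal_three L α w
  haveI := locallyCompactSpace_chartTorusGLoc L α w S'
  haveI := isHaarMeasure_chartHaarGLoc L α w S'
  haveI := isInvInvariant_chartHaarGLoc L α w S'
  rw [chartOrbGLoc_ofReal, Complex.ofReal_re]
  have hopen : (chartQuotientMeasureGLoc L α w S' νw).IsOpenPosMeasure := by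
    unfold chartQuotientMeasureGLoc
    exact isOpenPosMeasure_quotientMeasure (chartTorusGLoc L α w S') (isClosed_chartTorusGLoc L α w S') (chartHaarGLoc L α w S') νw
  haveI := hopen
  haveI : IsFiniteMeasureOnCompacts (chartQuotientMeasureGLoc L α w S' νw) := by
    unfold chartQuotientMeasureGLoc
    infer_instance
  have hw' : ¬ (w ∈ S' ∧ w ∈ splitChartPlaces L α) := fun h => hw h.1
  have hint : Integrable (descConj (gprimeBlockAt L α w S' cw) (chartTorusGLoc L α w S') (forall_mem_chartTorusGLoc_comm L α w S' cw) f)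
      (chartQuotientMeasureGLoc L α w S' νw) :=
    integrable_descConj_of_uniformlyProper (chartTorusGLoc L α w S') (forall_mem_chartTorusGLoc_comm L α w S')
      (fun K hK hKc C hC => uniformlyProper_gprimeBlock_cpt_of_injective L α S' hα hw' (chartTorusGLoc L α w S') K hK hKc C hC)
      (chartQuotientMeasureGLoc L α w S' νw) hf hfc hcw
  have hbox : 0 < (chartHaarGLoc L α w S' (chartBoxImgGLoc L α w S')).toReal := by
    have hm : 0 < chartHaarGLoc L α w S' (chartBoxImgGLoc L α w S') := by
      rw [chartBoxImgGLoc_eq_univ_of_not_mem L α w S' hα hS' hw]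
      exact isOpen_univ.measure_pos _ Set.univ_nonempty
    exact ENNReal.toReal_pos hm.ne' (chartHaarGLoc_chartBoxImgGLoc_lt_top L α w S').ne
  refine mul_pos hbox ?_
  exact integral_descConj_pos_of_nonneg (gprimeBlockAt L α w S' cw) (chartTorusGLoc L α w S') (forall_mem_chartTorusGLoc_comm L α w S' cw)
    (chartQuotientMeasureGLoc L α w S' νw) hf h0 hint (x₀ := 1) (by simpa using hpos.ne')

end Positivity

/-! ## §3 The `S₃`-slot sum of the one-place functionals -/

section SlotSum

variable (L : Type) [Field L] [NumberField L] [IsCMField L] (α : Fin 3 → L) (w : {w : InfinitePlace L // IsComplex w}) (S' : Finset {w : InfinitePlace L // IsComplex w})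
  [MeasurableSpace ↥(archLocal L 3 (Matrix.diagonal α) w)] [BorelSpace ↥(archLocal L 3 (Matrix.diagonal α) w)]
  (νw : Measure ↥(archLocal L 3 (Matrix.diagonal α) w)) [νw.IsHaarMeasure] [νw.IsMulRightInvariant]

/-- **At a compact-chart place the slot sum is a function of the phases `e^{i cw_k}` only** (★ `gprimeBlockAt_eq_of_not_mem_of_circleExp_eq`, ★ `chartOrbGLoc_congr`).
[cite: Rogawski1990, §3.6 p. 28; §8.2 p. 122] -/
theorem sum_perm_chartOrbGLoc_congr_of_circleExp_eq (hw : w ∉ S') (f : ↥(archLocal L 3 (Matrix.diagonal α) w) → ℂ) {cw cw' : Fin 3 → ℝ}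
    (h : ∀ k, Circle.exp (cw k) = Circle.exp (cw' k)) :
    ∑ σ : Equiv.Perm (Fin 3), chartOrbGLoc L α w S' νw f (cw ∘ σ) = ∑ σ : Equiv.Perm (Fin 3), chartOrbGLoc L α w S' νw f (cw' ∘ σ) :=
  Finset.sum_congr rfl fun σ _ => chartOrbGLoc_congr L α w S' νw f (gprimeBlockAt_eq_of_not_mem_of_circleExp_eq L α w S' hw fun k => h (σ k))

/-- **The slot sum is `S₃`-invariant**: `Σ_σ F((cw ∘ τ) ∘ σ) = Σ_σ F(cw ∘ σ)` (reindex `σ ↦ τσ`). [cite: Shelstad1979, Lemma 4.2 p. 23] -/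
theorem sum_perm_chartOrbGLoc_comp_perm (f : ↥(archLocal L 3 (Matrix.diagonal α) w) → ℂ) (cw : Fin 3 → ℝ) (τ : Equiv.Perm (Fin 3)) :
    ∑ σ : Equiv.Perm (Fin 3), chartOrbGLoc L α w S' νw f ((cw ∘ τ) ∘ σ) = ∑ σ : Equiv.Perm (Fin 3), chartOrbGLoc L α w S' νw f (cw ∘ σ) := by
  have h : ∀ σ : Equiv.Perm (Fin 3), (cw ∘ ⇑τ) ∘ ⇑σ = cw ∘ ⇑(τ * σ) := fun σ => rfl
  simp_rw [h]
  exact (Group.mulLeft_bijective τ).sum_comp fun σ : Equiv.Perm (Fin 3) => chartOrbGLoc L α w S' νw f (cw ∘ ⇑σ)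

/-- **The slot sum is `C^∞` on the one-place regular set of a compact-chart place** (★ layer (i) `contDiffOn_chartOrbGLoc_cpt_of_injective`, each slot relabelling being a linear map
preserving the regular set). [cite: Shelstad1979, §4 pp. 22–23] [cite: Varadarajan1989, §2.4 Thm. 8] -/
theorem contDiffOn_sum_perm_chartOrbGLoc (hα : ∀ i, α i ≠ 0) (hw : ¬ (w ∈ S' ∧ w ∈ splitChartPlaces L α))
    {f : ↥(archLocal L 3 (Matrix.diagonal α) w) → ℂ} (fa : Matrix (Fin 3) (Fin 3) ℂ → ℂ) (hfa : ContDiff ℝ ∞ fa)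
    (hf : ∀ g : ↥(archLocal L 3 (Matrix.diagonal α) w), f g = fa (((g : GL (Fin 3) ℂ)) : Matrix (Fin 3) (Fin 3) ℂ)) (hfc : HasCompactSupport f) :
    ContDiffOn ℝ ∞ (fun cw : Fin 3 → ℝ => ∑ σ : Equiv.Perm (Fin 3), chartOrbGLoc L α w S' νw f (cw ∘ σ))
      {cw : Fin 3 → ℝ | Function.Injective fun i : Fin 3 => Circle.exp (cw i)} := by
  refine ContDiffOn.sum fun σ _ => ?_
  have hlin : ContDiff ℝ ∞ fun cw : Fin 3 → ℝ => cw ∘ ⇑σ := contDiff_pi.2 fun i => contDiff_apply ℝ ℝ (σ i)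
  refine (contDiffOn_chartOrbGLoc_cpt_of_injective L α w S' νw hα hw fa hfa hf hfc).comp hlin.contDiffOn fun cw hcw => ?_
  exact hcw.comp σ.injective

/-- **The slot sum of a non-negative `f` has POSITIVE real part at a regular compact-chart point where `f(gprimeBlockAt cw) > 0`** (the `σ = 1` term is positive, §2; the others are `≥ 0`).
[cite: Shelstad1979, Lemma 4.2 p. 23] [cite: Rogawski1990, §8.2 p. 122] -/
theorem sum_perm_chartOrbGLoc_ofReal_re_pos (hα : ∀ i, α i ≠ 0) (hS' : ∀ w, w ∈ S' → w ∈ splitChartPlaces L α) (hw : w ∉ S')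
    {f : ↥(archLocal L 3 (Matrix.diagonal α) w) → ℝ} (hf : Continuous f) (hfc : HasCompactSupport f) (h0 : ∀ g, 0 ≤ f g) {cw : Fin 3 → ℝ}
    (hcw : Function.Injective fun i : Fin 3 => Circle.exp (cw i)) (hpos : 0 < f (gprimeBlockAt L α w S' cw)) :
    0 < (∑ σ : Equiv.Perm (Fin 3), chartOrbGLoc L α w S' νw (fun g => ((f g : ℝ) : ℂ)) (cw ∘ σ)).re := by
  rw [Complex.re_sum, ← Finset.add_sum_erase _ _ (Finset.mem_univ (1 : Equiv.Perm (Fin 3)))]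
  refine add_pos_of_pos_of_nonneg ?_ (Finset.sum_nonneg fun σ _ => (chartOrbGLoc_ofReal_re_nonneg L α w S' νw h0 _).1)
  rw [Equiv.Perm.coe_one, Function.comp_id]
  exact chartOrbGLoc_ofReal_re_pos L α w S' νw hα hS' hw hf hfc h0 hcw hpos

end SlotSum

/-! ## §4 The regular one-place EP generator -/

section Head

variable (L : Type) [Field L] [NumberField L] [IsCMField L] (α : Fin 3 → L) (w : {w : InfinitePlace L // IsComplex w})
  [MeasurableSpace ↥(archLocal L 3 (Matrix.diagonal α) w)] [BorelSpace ↥(archLocal L 3 (Matrix.diagonal α) w)]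
  (νw : Measure ↥(archLocal L 3 (Matrix.diagonal α) w)) [νw.IsHaarMeasure] [νw.IsMulRightInvariant]

/-- A unit triple has angles: `‖l_i‖ = 1 ⇒ l_i = e^{iθ_i}`. [cite: Rogawski1990, §3.6 p. 28] -/
theorem exists_angles_of_norm_eq_one {l : Fin 3 → ℂ} (hl : ∀ i, ‖l i‖ = 1) : ∃ θ : Fin 3 → ℝ, ∀ i, l i = Complex.exp ((θ i : ℂ) * I) := by
  choose θ hθ using fun i => (Complex.norm_eq_one_iff (l i)).1 (hl i)
  exact ⟨θ, fun i => (hθ i).symm⟩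

omit [NumberField L] [IsCMField L] in
/-- At a compact-chart place the `w`-class of a coordinate is the symmetric datum of its phases. [cite: Rogawski1990, §3.6 p. 28] [cite: Bouaziz1994IntegralesOrbitales, §5.1 p. 588] -/
theorem bzClassMapG_apply_of_not_mem {S' : Finset {w : InfinitePlace L // IsComplex w}} (c : {w : InfinitePlace L // IsComplex w} → Fin 3 → ℝ) (hw : w ∉ S') :
    bzClassMapG S' c w = esymm3 (fun i => Complex.exp ((c w i : ℂ) * I)) := by
  rw [bzClassMapG_apply, chartEigG_of_not_mem hw]

/-- **THE REGULAR ONE-PLACE EP GENERATOR**: for a house frame `α` (`α_i ≠ 0`), a complex place `w`, a Haar measure `ν_w` on `U(α)_w` and a REGULAR ELLIPTIC base class `b = esymm3 l` (`‖l_i‖ = 1`,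
`l` injective), `EPGeneratorAt L α w ν_w (esymm3 l)` holds: with `f` the one-place bump of §1 at `γ₀ = gprimeBlockAt α w ∅ θ₀` (`l = e^{iθ₀}`) — the SPLIT reading near `b` is vacuous (★ F1
`exists_pos_not_split_and_compact_nearG` against the compact witness `bzClassMapG ∅ θ₀ w = b`), and on every compact chart `S′ ∌ w` (★ `chartOrbGLoc_eq_of_mem_iff`: `= ∅`-label) the slot
sum equals `h(class)` with `h = χ · (Σ_σ chartOrbGLoc … (τ(·) ∘ σ))` smooth on `ℂ³` (★ F3 section `τ`, cutoff `χ`, ★ F6b permutation identity, §3) and `h b = Σ_σ chartOrbGLoc … (θ₀ ∘ σ)` of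
positive real part (§2–§3). [cite: Rogawski1990, §8.2 p. 122] [cite: Shelstad1979, §4 p. 22, Lemma 4.2 p. 23] [cite: Bouaziz1994IntegralesOrbitales, §6.2 p. 591] -/
theorem epGeneratorAt_esymm3_of_injective (hα : ∀ i, α i ≠ 0) {l : Fin 3 → ℂ} (hl : ∀ i, ‖l i‖ = 1) (hinj : Function.Injective l) :
    EPGeneratorAt L α w νw (esymm3 l) := by
  -- ## the base class in angles; the base coordinate is regular
  obtain ⟨θ₀, hθ₀⟩ := exists_angles_of_norm_eq_one hl
  have hlθ : l = fun i => Complex.exp ((θ₀ i : ℂ) * I) := funext hθ₀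
  have hθinj' : Function.Injective fun i : Fin 3 => Complex.exp ((θ₀ i : ℂ) * I) := by rw [← hlθ]; exact hinj
  have hθinj : Function.Injective fun i : Fin 3 => Circle.exp (θ₀ i) := by
    intro i j hij
    apply hθinj'
    show Complex.exp ((θ₀ i : ℂ) * I) = Complex.exp ((θ₀ j : ℂ) * I)
    rw [← Circle.coe_exp, ← Circle.coe_exp]
    exact congrArg Subtype.val hij
  set b : ℂ × ℂ × ℂ := esymm3 l with hb
  have hbθ : esymm3 (fun i => Complex.exp ((θ₀ i : ℂ) * I)) = b := by rw [hb, hlθ]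
  have hdisc : cubicDisc b ≠ 0 := (cubicDisc_esymm3_ne_zero_iff l).2 hinj
  -- the empty label: compact chart at `w`, admissible
  have hS₀ : ∀ w' : {w : InfinitePlace L // IsComplex w}, w' ∈ (∅ : Finset {w : InfinitePlace L // IsComplex w}) → w' ∈ splitChartPlaces L α :=
    fun w' h => absurd h (Finset.notMem_empty w')
  have hw₀ : w ∉ (∅ : Finset {w : InfinitePlace L // IsComplex w}) := Finset.notMem_empty w
  have hw₀' : ¬ (w ∈ (∅ : Finset {w : InfinitePlace L // IsComplex w}) ∧ w ∈ splitChartPlaces L α) := fun h => hw₀ h.1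
  have hbase : bzClassMapG (∅ : Finset {w : InfinitePlace L // IsComplex w}) (fun _ => θ₀) w = b := by
    rw [bzClassMapG_apply_of_not_mem L w _ hw₀, hbθ]
  -- ## the one-place bump at `γ₀ = gprimeBlockAt α w ∅ θ₀`
  obtain ⟨f₀, hf₀c, hf₀s, hf₀0, hf₀1, fa, hfa, hfaf⟩ :=
    exists_onePlaceBump_eq_one L α w (gprimeBlockAt L α w (∅ : Finset {w : InfinitePlace L // IsComplex w}) θ₀)
  have hfs : HasCompactSupport (fun g : ↥(archLocal L 3 (Matrix.diagonal α) w) => ((f₀ g : ℝ) : ℂ)) := hf₀s.comp_left Complex.ofReal_zero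
  -- ## the slot sum `Φ` of the empty-label one-place functionals
  set Φ : (Fin 3 → ℝ) → ℂ := fun cw => ∑ σ : Equiv.Perm (Fin 3),
    chartOrbGLoc L α w (∅ : Finset {w : InfinitePlace L // IsComplex w}) νw (fun g => ((f₀ g : ℝ) : ℂ)) (cw ∘ σ) with hΦdef
  have hΦs : ContDiffOn ℝ ∞ Φ {cw : Fin 3 → ℝ | Function.Injective fun i : Fin 3 => Circle.exp (cw i)} :=
    contDiffOn_sum_perm_chartOrbGLoc L α w ∅ νw hα hw₀' fa hfa hfaf hfs
  have hΦpos : ∀ cw : Fin 3 → ℝ, (Function.Injective fun i : Fin 3 => Circle.exp (cw i)) →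
      0 < f₀ (gprimeBlockAt L α w (∅ : Finset {w : InfinitePlace L // IsComplex w}) cw) → 0 < (Φ cw).re :=
    fun cw hcw hpos => sum_perm_chartOrbGLoc_ofReal_re_pos L α w ∅ νw hα hS₀ hw₀ hf₀c hf₀s hf₀0 hcw hpos
  have hΦper : ∀ cw cw' : Fin 3 → ℝ, (∀ k, Circle.exp (cw k) = Circle.exp (cw' k)) → Φ cw = Φ cw' :=
    fun cw cw' h => sum_perm_chartOrbGLoc_congr_of_circleExp_eq L α w ∅ νw hw₀ _ h
  have hΦsym : ∀ (cw : Fin 3 → ℝ) (τ : Equiv.Perm (Fin 3)), Φ (cw ∘ τ) = Φ cw :=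
    fun cw τ => sum_perm_chartOrbGLoc_comp_perm L α w ∅ νw _ cw τ
  -- ## the smooth local section of the class map at `b`, shrunk so that it lands in the regular set
  obtain ⟨V, hV, hbV, τ, hτ, hτb, hτsec⟩ := exists_section_compactPlaceG θ₀ hθinj'
  rw [hbθ] at hbV hτb
  have hV' : IsOpen (V ∩ τ ⁻¹' {cw : Fin 3 → ℝ | Function.Injective fun i : Fin 3 => Circle.exp (cw i)}) :=
    hτ.continuousOn.isOpen_inter_preimage hV isOpen_setOf_injective_circleExpLoc
  have hbV' : b ∈ V ∩ τ ⁻¹' {cw : Fin 3 → ℝ | Function.Injective fun i : Fin 3 => Circle.exp (cw i)} :=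
    ⟨hbV, by rw [Set.mem_preimage, hτb]; exact hθinj⟩
  obtain ⟨r, hr, hball⟩ := Metric.isOpen_iff.1 hV' b hbV'
  -- ## F1: no split chart point near the regular class `b`
  obtain ⟨δ, hδ, hδP⟩ := exists_pos_not_split_and_compact_nearG (W := {w : InfinitePlace L // IsComplex w}) b hdisc
  -- ## the radius and the cutoff
  set ε : ℝ := min (r / 3) δ with hεdef
  have hε : 0 < ε := lt_min (by positivity) hδ
  have hεr : 2 * ε < r := by
    have : ε ≤ r / 3 := min_le_left _ _
    linarith
  obtain ⟨χ, hχ, hχ1, hχsupp⟩ := exists_contDiff_eq_one_closedBall_tsupport_subset b hε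
  have hsuppV : tsupport χ ⊆ V ∩ τ ⁻¹' {cw : Fin 3 → ℝ | Function.Injective fun i : Fin 3 => Circle.exp (cw i)} :=
    hχsupp.trans ((Metric.ball_subset_ball hεr.le).trans hball)
  -- ## the class function `h = χ · (Φ ∘ τ)`
  have hΦτ : ContDiffOn ℝ ∞ (fun z => Φ (τ z)) (V ∩ τ ⁻¹' {cw : Fin 3 → ℝ | Function.Injective fun i : Fin 3 => Circle.exp (cw i)}) :=
    hΦs.comp (hτ.mono Set.inter_subset_left) fun z hz => hz.2
  have hh : ContDiff ℝ ∞ fun z : ℂ × ℂ × ℂ => ((χ z : ℝ) : ℂ) * Φ (τ z) := contDiff_ofReal_mul_of_tsupport_subset hV' hχ hsuppV hΦτ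
  refine (epGeneratorAt_iff b).2 ⟨ε, hε, fun g => ((f₀ g : ℝ) : ℂ), ⟨fa, hfa, hfaf⟩, hfs, fun z => ((χ z : ℝ) : ℂ) * Φ (τ z), hh, ?_, ?_, ?_⟩
  · -- `h b ≠ 0`: `h b = Φ θ₀` has positive real part
    have h1 : χ b = 1 := hχ1 b (Metric.mem_closedBall_self hε.le)
    show ((χ b : ℝ) : ℂ) * Φ (τ b) ≠ 0
    rw [h1, Complex.ofReal_one, one_mul, hτb]
    intro h0
    have hp := hΦpos θ₀ hθinj (by rw [hf₀1]; exact one_pos)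
    rw [h0, Complex.zero_re] at hp
    exact lt_irrefl _ hp
  · -- the split clause is vacuous near a regular class
    intro S' c hwS _ hdist
    exact (hδP S' ∅ c (fun _ => θ₀) w hwS hw₀ (hdist.trans_le (min_le_right _ _)) (by rw [hbase, dist_self]; exact hδ)).elim
  · -- the compact clause
    intro S' c hwS _ hdist
    -- the one-place functional of `S′ ∌ w` is that of the empty label (the regularity of `c w` itself is not even used: that of the section value `τ z` suffices)
    have hS'0 : (∑ σ : Equiv.Perm (Fin 3), chartOrbGLoc L α w S' νw (fun g => ((f₀ g : ℝ) : ℂ)) (c w ∘ σ)) = Φ (c w) :=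
      Finset.sum_congr rfl fun σ _ => chartOrbGLoc_eq_of_mem_iff L α w νw (iff_of_false hwS hw₀) _ _
    rw [hS'0]
    show Φ (c w) = ((χ (bzClassMapG S' c w) : ℝ) : ℂ) * Φ (τ (bzClassMapG S' c w))
    -- the class `z` and the section value `τ z`
    have hzc : bzClassMapG S' c w = esymm3 (fun i => Complex.exp ((c w i : ℂ) * I)) := bzClassMapG_apply_of_not_mem L w c hwS
    have hzr : dist (bzClassMapG S' c w) b < r := hdist.trans_le ((min_le_left _ _).trans (by linarith))
    have hzV' := hball (Metric.mem_ball.2 hzr)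
    have h1 : χ (bzClassMapG S' c w) = 1 := hχ1 _ (Metric.mem_closedBall.2 hdist.le)
    have hmem : esymm3 (fun i => Complex.exp ((c w i : ℂ) * I)) ∈ V := hzc ▸ hzV'.1
    obtain ⟨hsec, hinjτ⟩ := hτsec (c w) hmem
    obtain ⟨π, hπ⟩ := exists_perm_of_esymm3_eq hsec.symm hinjτ
    have hper : ∀ k, Circle.exp (τ (bzClassMapG S' c w) k) = Circle.exp ((c w ∘ ⇑π) k) := fun k =>
      Circle.ext (by rw [Circle.coe_exp, Circle.coe_exp, hzc]; exact hπ k)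
    rw [h1, Complex.ofReal_one, one_mul, hΦper _ _ hper, hΦsym]

/-- **THE SAME, `cubicDisc`-SPELLING** (the dealer's text: `b = esymm3 l`, `‖l_i‖ = 1`, `cubicDisc b ≠ 0`; ★ `cubicDisc_esymm3_ne_zero_iff`).
[cite: Rogawski1990, §8.2 p. 122] [cite: Bouaziz1994IntegralesOrbitales, §6.2 p. 591] -/
theorem epGeneratorAt_esymm3_of_cubicDisc_ne_zero (hα : ∀ i, α i ≠ 0) {l : Fin 3 → ℂ} (hl : ∀ i, ‖l i‖ = 1) (hdisc : cubicDisc (esymm3 l) ≠ 0) :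
    EPGeneratorAt L α w νw (esymm3 l) :=
  epGeneratorAt_esymm3_of_injective L α w νw hα hl ((cubicDisc_esymm3_ne_zero_iff l).1 hdisc)

end Head

end Literature.NumberTheory.Rogawski1990

end
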